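import Summits.NavierStokesRegularity.NavierStokesRegularity.Theorems.HeredityAtOne.Negative.SlowPressureTemplate
import Summits.NavierStokesRegularity.FluidComputer.PalasekTowerRegisterGlobalHeredity

/-!
# The «slow pressure» continuation templates AT EVERY LEVEL `k ≥ 1` — `HeredityAt k`, `HeredityFrom k₀`,
# `HeredityFromTwo`

Cell `ns-blowup`, seat `ns-blowup-refuter4` (g4; LEDGER REFUTER of the route `PalasekTowerBreakdown`,
items stmt-NavierStokesRegularity-19250 `HeredityFromTwo` and -19249 `HeredityAtOne`). NEGATIVE-LANE
hygiene lemmas: the level-`k` twins of `Theorems/HeredityAtOne/Negative/SlowPressureTemplate.lean`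
(p452271, level `1`). LABEL: E–C typing (KERNEL bookkeeping: pure logic on top of the landed rate theorem
`Stage.exists_window_pressureRate_quiet` through `Stage.not_slowPressure_window` /
`Stage.not_gradPressure_le_window`). WHAT THIS IS NOT: not Navier–Stokes evidence — no flow, stage or
schedule is constructed; `HeredityAt k`-type statements are neither asserted nor refuted here; every
theorem below is an implication or an equivalence between OPEN hypotheses.

Content (any level `k ≥ 1`, pinned rigid quiet wide schedule `S`, registered level-`k` stage `s`):

* `slowPressureTemplateAt_iff_noExtension`, `gradPressureTemplateAt_iff_noExtension` — the `s'`-form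
  template hypothesis «every registered level-`(k+1)` extension of `s` pushes slowly on `(τ_k, τ_{k+1}]`»
  is EQUIVALENT to «`s` has no registered level-`(k+1)` extension» (costume warning, as at level `1`);
* `not_heredityAt_iff_exists_noExtension` — `¬HeredityAt k` is by definition the existence of a pinned
  rigid quiet wide schedule with a registered level-`k` stage without extension;
* **`not_heredityAt_of_slowPressure_continuation`**, `not_heredityAt_of_gradPressure_le_continuation` — the
  W14-free CONTINUATION form at level `k`: if EVERY finite-energy classical continuation `(u, p)` of `s`
  to `[0, τ_{k+1}]` (same force, agreeing with `s` on `[0, τ_k]`) pushes slower than `|Du|²_F + Λ‖u‖`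
  (resp. has `‖∇p‖ ≤ P`) at its running global speed maxima in the band `(c₂Y_k, c₁Y_{k+1}]`, with
  `Λ(τ_{k+1} − τ_k) < c₁Y_{k+1} − c₂Y_k` (resp. `P(…) < …`), then `¬HeredityAt k`;
* `not_heredityFrom_of_not_heredityAt`, **`not_heredityFromTwo_of_slowPressure_continuation`**,
  `not_heredityFromTwo_of_gradPressure_le_continuation` — hence `¬HeredityFrom k₀` for every `k₀ ≤ k`,
  in particular the route item `HeredityFromTwo` (`= HeredityFrom 2`) from ONE such stage at ONE level
  `k ≥ 2`.

VACUITY WARNING (K61/K62/KJ-10 of record): every theorem needs a REGISTERED LEVEL-`k` STAGE, `k ≥ 1`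
(resp. `k ≥ 2`); none is known (R2-hard), so nothing here bites items 19249/19250 today.

References: S. Palasek, arXiv:2605.13827 §4 (the tower's hand-over) [cite: Palasek2026ElementaryModel, §4];
T. Tao, Anal. PDE 6 (2013), Cor. 11.4 (the uniqueness the `s'`-form silently needs) [cite: Tao2011, Cor. 11.4].
-/

noncomputable section

namespace Summit.NavierStokesRegularity.HeredityFromTwoSlowPressure

open Set MeasureTheory
open scoped ENNReal InnerProductSpace RealInnerProductSpace
open Summit.NavierStokesRegularity.NavierStokesRegularity.Theses
open Summit.NavierStokesRegularity.FluidComputer.PalasekTowerClayBridge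
open Summit.NavierStokesRegularity.HeredityAtOneSlowPressure
open Literature.Analysis.FluidPDE

variable {S : Schedule TowerRates.wide} {k : ℕ}

/-! ## §1 The `s'`-form template hypothesis at level `k` says exactly «no extension» -/

/-- **The slow-pressure template hypothesis at level `k ≥ 1` says exactly «no extension».** For a quiet
wide schedule, a registered level-`k` stage `s` and any slope `0 ≤ Λ` with
`Λ(τ_{k+1} − τ_k) < c₁Y_{k+1} − c₂Y_k`: «every registered level-`(k+1)` extension of `s` pushes slowly
at its running speed maxima in the hand-over band» ⟺ «`s` has no registered level-`(k+1)` extension».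
[cite: Palasek2026ElementaryModel, §4] -/
theorem slowPressureTemplateAt_iff_noExtension (hQ : S.Quiet) (hk : 1 ≤ k)
    (s : Stage 1 TowerRates.wide S (Margins.routeG TowerRates.wide) k) {Λ : ℝ} (hΛ0 : 0 ≤ Λ)
    (hΛ : Λ * (S.τ (k + 1) - S.τ k) <
      S.c₁ * TowerRates.wide.Y (k + 1) - S.c₂ * TowerRates.wide.Y k) :
    (∀ s' : Stage 1 TowerRates.wide S (Margins.routeG TowerRates.wide) (k + 1), s.Extends s' →
      ∀ t ∈ Ioc (S.τ k) (S.τ (k + 1)), ∀ x : EuclideanSpace ℝ (Fin 3),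
        (∀ y, ‖s'.u t y‖ ≤ ‖s'.u t x‖) →
        S.c₂ * TowerRates.wide.Y k < ‖s'.u t x‖ → ‖s'.u t x‖ ≤ S.c₁ * TowerRates.wide.Y (k + 1) →
        (∀ t' ∈ Ico 0 t, ∀ y, ‖s'.u t' y‖ < ‖s'.u t x‖) →
        - ⟪s'.u t x, gradient (s'.p t) x⟫ <
          1 * frobeniusNormSq (fderiv ℝ (s'.u t) x) + Λ * ‖s'.u t x‖) ↔
    ∀ s' : Stage 1 TowerRates.wide S (Margins.routeG TowerRates.wide) (k + 1), ¬ s.Extends s' := by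
  constructor
  · intro h s' hs'
    exact Stage.not_slowPressure_window one_pos s' hQ (j := k) hk le_rfl hΛ0 hΛ (h s' hs')
  · intro h s' hs'
    exact absurd hs' (h s')

/-- **The gradient-form template hypothesis at level `k ≥ 1` says exactly «no extension»**: any `0 ≤ P`
with `P(τ_{k+1} − τ_k) < c₁Y_{k+1} − c₂Y_k`. [cite: Palasek2026ElementaryModel, §4] -/
theorem gradPressureTemplateAt_iff_noExtension (hQ : S.Quiet) (hk : 1 ≤ k)
    (s : Stage 1 TowerRates.wide S (Margins.routeG TowerRates.wide) k) {P : ℝ} (hP0 : 0 ≤ P)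
    (hP : P * (S.τ (k + 1) - S.τ k) <
      S.c₁ * TowerRates.wide.Y (k + 1) - S.c₂ * TowerRates.wide.Y k) :
    (∀ s' : Stage 1 TowerRates.wide S (Margins.routeG TowerRates.wide) (k + 1), s.Extends s' →
      ∀ t ∈ Ioc (S.τ k) (S.τ (k + 1)), ∀ x : EuclideanSpace ℝ (Fin 3),
        (∀ y, ‖s'.u t y‖ ≤ ‖s'.u t x‖) →
        S.c₂ * TowerRates.wide.Y k < ‖s'.u t x‖ → ‖s'.u t x‖ ≤ S.c₁ * TowerRates.wide.Y (k + 1) →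
        (∀ t' ∈ Ico 0 t, ∀ y, ‖s'.u t' y‖ < ‖s'.u t x‖) →
        ‖gradient (s'.p t) x‖ ≤ P) ↔
    ∀ s' : Stage 1 TowerRates.wide S (Margins.routeG TowerRates.wide) (k + 1), ¬ s.Extends s' := by
  constructor
  · intro h s' hs'
    exact Stage.not_gradPressure_le_window one_pos s' hQ (j := k) hk le_rfl hP0 hP (h s' hs')
  · intro h s' hs'
    exact absurd hs' (h s')

/-! ## §2 `¬HeredityAt k` is its own counterexample clause; the continuation form at level `k` -/

/-- **`¬HeredityAt k` unfolded**: heredity at level `k` fails iff some pinned rigid quiet wide schedule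
carries a registered level-`k` stage with no registered level-`(k+1)` extension. Pure logic.
[cite: Palasek2026ElementaryModel, §4] -/
theorem not_heredityAt_iff_exists_noExtension :
    ¬ HeredityAt k ↔
      ∃ S : Schedule TowerRates.wide, S.Pins 8 (6 / 5) ∧ S.Rigid ∧ S.Quiet ∧
        ∃ s : Stage 1 TowerRates.wide S (Margins.routeG TowerRates.wide) k,
          ∀ s' : Stage 1 TowerRates.wide S (Margins.routeG TowerRates.wide) (k + 1), ¬ s.Extends s' := by
  constructor
  · intro h
    by_contra hne
    apply h
    intro S hP hR hQ s
    by_contra hs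
    exact hne ⟨S, hP, hR, hQ, s, fun s' hs' => hs ⟨s', hs'⟩⟩
  · rintro ⟨S, hP, hR, hQ, s, hs⟩ hH
    obtain ⟨s', hs'⟩ := hH S hP hR hQ s
    exact hs s' hs'

/-- One registered level-`k` stage without extension on a pinned rigid quiet wide schedule refutes
`HeredityAt k`. [cite: Palasek2026ElementaryModel, §4] -/
theorem not_heredityAt_of_noExtension (hP : S.Pins 8 (6 / 5)) (hR : S.Rigid) (hQ : S.Quiet)
    (s : Stage 1 TowerRates.wide S (Margins.routeG TowerRates.wide) k)
    (h : ∀ s' : Stage 1 TowerRates.wide S (Margins.routeG TowerRates.wide) (k + 1), ¬ s.Extends s') :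
    ¬ HeredityAt k :=
  not_heredityAt_iff_exists_noExtension.2 ⟨S, hP, hR, hQ, s, h⟩

/-- **Continuation-form template at level `k ≥ 1` (rate form, W14-free).** ONE pinned rigid quiet wide
schedule and ONE registered level-`k` stage `s` such that EVERY finite-energy classical continuation
`(u, p)` of `s` to `[0, τ_{k+1}]` (same force, agreeing with `s` on `[0, τ_k]`) pushes slower than
`|Du|²_F + Λ‖u‖` at each running global speed maximum in the band `(c₂Y_k, c₁Y_{k+1}]` of the window
`(τ_k, τ_{k+1}]`, for some `0 ≤ Λ` with `Λ(τ_{k+1} − τ_k) < c₁Y_{k+1} − c₂Y_k`, refutes `HeredityAt k`: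
a registered extension `s'` would be such a continuation, and `Stage.not_slowPressure_window` gives it a
fast instant. VACUITY: needs a registered level-`k` stage. [cite: Palasek2026ElementaryModel, §4] -/
theorem not_heredityAt_of_slowPressure_continuation (hk : 1 ≤ k) (hP : S.Pins 8 (6 / 5)) (hR : S.Rigid)
    (hQ : S.Quiet) (s : Stage 1 TowerRates.wide S (Margins.routeG TowerRates.wide) k) {Λ : ℝ}
    (hΛ0 : 0 ≤ Λ)
    (hΛ : Λ * (S.τ (k + 1) - S.τ k) < S.c₁ * TowerRates.wide.Y (k + 1) - S.c₂ * TowerRates.wide.Y k)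
    (h : ∀ (u : ℝ → EuclideanSpace ℝ (Fin 3) → EuclideanSpace ℝ (Fin 3))
        (p : ℝ → EuclideanSpace ℝ (Fin 3) → ℝ),
        IsClassicalNSSolutionOn (Icc 0 (S.τ (k + 1))) 1 S.f u p →
        (∀ t ∈ Icc 0 (S.τ k), u t = s.u t ∧ p t = s.p t) →
        (∃ C : ℝ≥0∞, C < ⊤ ∧ ∀ t ∈ Icc 0 (S.τ (k + 1)), ∫⁻ x, ‖u t x‖ₑ ^ 2 ≤ C) →
        ∀ t ∈ Ioc (S.τ k) (S.τ (k + 1)), ∀ x : EuclideanSpace ℝ (Fin 3),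
          (∀ y, ‖u t y‖ ≤ ‖u t x‖) →
          S.c₂ * TowerRates.wide.Y k < ‖u t x‖ → ‖u t x‖ ≤ S.c₁ * TowerRates.wide.Y (k + 1) →
          (∀ t' ∈ Ico 0 t, ∀ y, ‖u t' y‖ < ‖u t x‖) →
          - ⟪u t x, gradient (p t) x⟫ < 1 * frobeniusNormSq (fderiv ℝ (u t) x) + Λ * ‖u t x‖) :
    ¬ HeredityAt k := by
  refine not_heredityAt_of_noExtension hP hR hQ s fun s' hs' => ?_
  exact Stage.not_slowPressure_window one_pos s' hQ (j := k) hk le_rfl hΛ0 hΛ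
    (h s'.u s'.p s'.classical hs' s'.energy)

/-- **Continuation-form template at level `k ≥ 1` (gradient form).** The same from a pressure-GRADIENT
bound `‖∇p‖ ≤ P` at the running maxima, `0 ≤ P`, `P(τ_{k+1} − τ_k) < c₁Y_{k+1} − c₂Y_k`.
[cite: Palasek2026ElementaryModel, §4] -/
theorem not_heredityAt_of_gradPressure_le_continuation (hk : 1 ≤ k) (hP : S.Pins 8 (6 / 5))
    (hR : S.Rigid) (hQ : S.Quiet) (s : Stage 1 TowerRates.wide S (Margins.routeG TowerRates.wide) k)
    {P : ℝ} (hP0 : 0 ≤ P)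
    (hPτ : P * (S.τ (k + 1) - S.τ k) < S.c₁ * TowerRates.wide.Y (k + 1) - S.c₂ * TowerRates.wide.Y k)
    (h : ∀ (u : ℝ → EuclideanSpace ℝ (Fin 3) → EuclideanSpace ℝ (Fin 3))
        (p : ℝ → EuclideanSpace ℝ (Fin 3) → ℝ),
        IsClassicalNSSolutionOn (Icc 0 (S.τ (k + 1))) 1 S.f u p →
        (∀ t ∈ Icc 0 (S.τ k), u t = s.u t ∧ p t = s.p t) →
        (∃ C : ℝ≥0∞, C < ⊤ ∧ ∀ t ∈ Icc 0 (S.τ (k + 1)), ∫⁻ x, ‖u t x‖ₑ ^ 2 ≤ C) →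
        ∀ t ∈ Ioc (S.τ k) (S.τ (k + 1)), ∀ x : EuclideanSpace ℝ (Fin 3),
          (∀ y, ‖u t y‖ ≤ ‖u t x‖) →
          S.c₂ * TowerRates.wide.Y k < ‖u t x‖ → ‖u t x‖ ≤ S.c₁ * TowerRates.wide.Y (k + 1) →
          (∀ t' ∈ Ico 0 t, ∀ y, ‖u t' y‖ < ‖u t x‖) →
          ‖gradient (p t) x‖ ≤ P) :
    ¬ HeredityAt k := by
  refine not_heredityAt_of_noExtension hP hR hQ s fun s' hs' => ?_
  exact Stage.not_gradPressure_le_window one_pos s' hQ (j := k) hk le_rfl hP0 hPτ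
    (h s'.u s'.p s'.classical hs' s'.energy)

/-! ## §3 From one level to `HeredityFrom k₀` and the route item `HeredityFromTwo` -/

/-- A failure of heredity at one level `k ≥ k₀` is a failure of heredity from `k₀` on (contrapositive of
`HeredityFrom.heredityAt`; stated negatively so that this Negative-lane file asserts no item positively).
[cite: Palasek2026ElementaryModel, §4] -/
theorem not_heredityFrom_of_not_heredityAt {k₀ : ℕ} (hk : k₀ ≤ k) (h : ¬ HeredityAt k) :
    ¬ HeredityFrom k₀ :=
  fun hF => h (hF.heredityAt hk)

/-- The route item `HeredityFromTwo` IS `HeredityFrom 2` (definitional unfolding of the Theses decl).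
[cite: Palasek2026ElementaryModel, §4] -/
theorem heredityFromTwo_iff : PalasekTowerBreakdown.HeredityFromTwo ↔ HeredityFrom 2 := Iff.rfl

/-- **Continuation-form template for the route item `HeredityFromTwo` (rate form).** ONE pinned rigid
quiet wide schedule and ONE registered stage `s` at ONE level `k ≥ 2` all of whose finite-energy
classical continuations to `[0, τ_{k+1}]` push slowly (as in
`not_heredityAt_of_slowPressure_continuation`) refute `HeredityFromTwo`. VACUITY: needs a registered
stage at a level `≥ 2`. [cite: Palasek2026ElementaryModel, §4] -/
theorem not_heredityFromTwo_of_slowPressure_continuation (hk : 2 ≤ k) (hP : S.Pins 8 (6 / 5))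
    (hR : S.Rigid) (hQ : S.Quiet) (s : Stage 1 TowerRates.wide S (Margins.routeG TowerRates.wide) k)
    {Λ : ℝ} (hΛ0 : 0 ≤ Λ)
    (hΛ : Λ * (S.τ (k + 1) - S.τ k) < S.c₁ * TowerRates.wide.Y (k + 1) - S.c₂ * TowerRates.wide.Y k)
    (h : ∀ (u : ℝ → EuclideanSpace ℝ (Fin 3) → EuclideanSpace ℝ (Fin 3))
        (p : ℝ → EuclideanSpace ℝ (Fin 3) → ℝ),
        IsClassicalNSSolutionOn (Icc 0 (S.τ (k + 1))) 1 S.f u p →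
        (∀ t ∈ Icc 0 (S.τ k), u t = s.u t ∧ p t = s.p t) →
        (∃ C : ℝ≥0∞, C < ⊤ ∧ ∀ t ∈ Icc 0 (S.τ (k + 1)), ∫⁻ x, ‖u t x‖ₑ ^ 2 ≤ C) →
        ∀ t ∈ Ioc (S.τ k) (S.τ (k + 1)), ∀ x : EuclideanSpace ℝ (Fin 3),
          (∀ y, ‖u t y‖ ≤ ‖u t x‖) →
          S.c₂ * TowerRates.wide.Y k < ‖u t x‖ → ‖u t x‖ ≤ S.c₁ * TowerRates.wide.Y (k + 1) →
          (∀ t' ∈ Ico 0 t, ∀ y, ‖u t' y‖ < ‖u t x‖) →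
          - ⟪u t x, gradient (p t) x⟫ < 1 * frobeniusNormSq (fderiv ℝ (u t) x) + Λ * ‖u t x‖) :
    ¬ PalasekTowerBreakdown.HeredityFromTwo :=
  not_heredityFrom_of_not_heredityAt hk
    (not_heredityAt_of_slowPressure_continuation (le_trans one_le_two hk) hP hR hQ s hΛ0 hΛ h)

/-- **Continuation-form template for `HeredityFromTwo` (gradient form).**
[cite: Palasek2026ElementaryModel, §4] -/
theorem not_heredityFromTwo_of_gradPressure_le_continuation (hk : 2 ≤ k) (hP : S.Pins 8 (6 / 5))
    (hR : S.Rigid) (hQ : S.Quiet) (s : Stage 1 TowerRates.wide S (Margins.routeG TowerRates.wide) k)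
    {P : ℝ} (hP0 : 0 ≤ P)
    (hPτ : P * (S.τ (k + 1) - S.τ k) < S.c₁ * TowerRates.wide.Y (k + 1) - S.c₂ * TowerRates.wide.Y k)
    (h : ∀ (u : ℝ → EuclideanSpace ℝ (Fin 3) → EuclideanSpace ℝ (Fin 3))
        (p : ℝ → EuclideanSpace ℝ (Fin 3) → ℝ),
        IsClassicalNSSolutionOn (Icc 0 (S.τ (k + 1))) 1 S.f u p →
        (∀ t ∈ Icc 0 (S.τ k), u t = s.u t ∧ p t = s.p t) →
        (∃ C : ℝ≥0∞, C < ⊤ ∧ ∀ t ∈ Icc 0 (S.τ (k + 1)), ∫⁻ x, ‖u t x‖ₑ ^ 2 ≤ C) →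
        ∀ t ∈ Ioc (S.τ k) (S.τ (k + 1)), ∀ x : EuclideanSpace ℝ (Fin 3),
          (∀ y, ‖u t y‖ ≤ ‖u t x‖) →
          S.c₂ * TowerRates.wide.Y k < ‖u t x‖ → ‖u t x‖ ≤ S.c₁ * TowerRates.wide.Y (k + 1) →
          (∀ t' ∈ Ico 0 t, ∀ y, ‖u t' y‖ < ‖u t x‖) →
          ‖gradient (p t) x‖ ≤ P) :
    ¬ PalasekTowerBreakdown.HeredityFromTwo :=
  not_heredityFrom_of_not_heredityAt hk
    (not_heredityAt_of_gradPressure_le_continuation (le_trans one_le_two hk) hP hR hQ s hP0 hPτ h)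

/-- … and the same single level-`k` stage (`k ≥ 1`) refutes K2G `EpisodeInductionG = HeredityFrom 1`,
i.e. the parent crux `EpisodeInduction` (stated on `HeredityFrom 1` to keep this file free of positive
route conclusions). [cite: Palasek2026ElementaryModel, §4] -/
theorem not_heredityFrom_one_of_not_heredityAt (hk : 1 ≤ k) (h : ¬ HeredityAt k) : ¬ HeredityFrom 1 :=
  not_heredityFrom_of_not_heredityAt hk h

end Summit.NavierStokesRegularity.HeredityFromTwoSlowPressure

end
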